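import Mathlib.Tactic.Ring
import Mathlib.Tactic.Linarith
import Mathlib.Tactic.LinearCombination
import Mathlib.Tactic.Positivity
import Mathlib.Data.Real.Basic
import HarnessLib
import Summits.HodgeConjecture.HodgeConjecture.Theorems.WeilClassTestFormatFiveThreeVertexGauge

/-!
# Conjecture N (hodge-weil ladder, GAPS G51b), format (5,3): THE CROSS LEMMA — Conjecture N on every cross configuration WITHOUT (P1)

Prover 2, generation 21 (note `run/shared/lean/b2b/hodge-weil/b2b-hweil-pv2-g21/RELAXATION-G21.md` §3). Setting of `CONJECTURE-N.md` §1, format (5,3),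
centred coordinates. A CROSS is a configuration all of whose roots lie on the two null lines through one base point `(As, us)`: in CORNER COORDINATES every
E-root is `(A_e, u_e) = (As + x_e + y_e, us + x_e − y_e)` and every F-root is `(B_g, v_g) = (As − p_g − q_g, us + q_g − p_g)` with `x, y, p, q ≥ 0` and
`x_e·y_e = p_g·q_g = 0` (H-line distance `x`/`p`, V-line distance `y`/`q`; generation 9's null-cone parametrisation). Put `X = Σx + Σp`, `M = Σy + Σq`,
`D⁺ = Σx² − Σp²`, `D⁻ = Σy² − Σq²`. THEN (centring of the charges ⟺ `2·us = M − X`):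
* `S_on_cross` : `S = D⁺ + D⁻ − (X − M)²/2`;  `Phi_eq_core_on_cross` : `Mo² + (S/2)T² − S² − 2S·us² = 2·(D⁻X² + D⁺M² − 2D⁺D⁻)` — the value of
  `Q₂ + Q₄` on a cross (`WeilClassTestFormatFiveThreeVertexGauge.G_on_cross_53`, which needs centring, P2, P4 but NOT P1);
* `cross_lemma_core` : `D⁺ ≤ X²`, `D⁻ ≤ M²`, `X, M ≥ 0`, `(X−M)²/2 ≤ D⁺ + D⁻` (i.e. `S ≥ 0`) ⟹ `D⁻X² + D⁺M² − 2D⁺D⁻ ≥ 0`. PROOF: with `p := X² − D⁺ ≥ 0`,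
  `m := M² − D⁻ ≥ 0` the form is `mX² + pM² − 2pm` and `p + m = (X+M)²/2 − S`; if `2p ≤ X²` it is `m(X² − 2p) + pM² ≥ 0` (symmetrically if `2m ≤ M²`);
  otherwise `p′ = p − X²/2 > 0`, `m′ = m − M²/2 > 0`, `p′ + m′ = XM − S`, and the form equals `X²M²/2 − 2p′m′ ≥ X²M²/2 − (XM − S)²/2 ≥ 0`;
* **`conjectureN_53_cross`** — THEOREM: every centred format-(5,3) cross configuration with `P2 = 0`, `P4 = 0` and `S ≥ 0` satisfies `Q₂ + Q₄ ≥ 0`.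
  Generation 9's `conjectureN_nullCone` (Literature/…/WeilClassTestNullCone) proved this WITH the full purity (P1, P2, P4) via the corner-moment identity
  `G₀ = μ₀₁(μ₁₀μ₃₀ − μ₂₀²)/(4μ₁₀)`; here (P1) is not used and the proof is the two-case estimate above. Equality holds exactly on the zero families of the
  lineage (one far E-root: `X = L, M = 0, D⁺ = L²`; two symmetric E-roots: `X = M = L`, `D⁺ = D⁻ = L²`). This is the 'cross' half of the note's P1-relaxation
  programme (the relaxed quadratic programme attains its minimum at crosses; its value there is this lemma).
Pure algebra; nothing here is a case of HC, a rung or a door edge; no statement of Markman's papers is used. New cell result ⇒ Summits/.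
-/

set_option linter.dupNamespace false

namespace Summit.HodgeConjecture.HodgeConjecture.WeilClassTestFormatFiveThreeCrossLemma

open Summit.HodgeConjecture.HodgeConjecture.WeilClassTestFormatFiveThreeVertexGauge

/-- THE CORE INEQUALITY. `D⁺ ≤ X²`, `D⁻ ≤ M²`, `X, M ≥ 0`, `(X − M)²/2 ≤ D⁺ + D⁻` ⟹ `D⁻·X² + D⁺·M² − 2·D⁺·D⁻ ≥ 0`. -/
theorem cross_lemma_core (X M Dp Dm : ℝ) (hX : 0 ≤ X) (hM : 0 ≤ M) (hp : Dp ≤ X ^ 2) (hm : Dm ≤ M ^ 2)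
    (hS : (X - M) ^ 2 / 2 ≤ Dp + Dm) :
    0 ≤ Dm * X ^ 2 + Dp * M ^ 2 - 2 * Dp * Dm := by
  -- p := X² − D⁺ ≥ 0, m := M² − D⁻ ≥ 0 ; the form is m·X² + p·M² − 2·p·m
  have hp' : 0 ≤ X ^ 2 - Dp := sub_nonneg.mpr hp
  have hm' : 0 ≤ M ^ 2 - Dm := sub_nonneg.mpr hm
  have key : Dm * X ^ 2 + Dp * M ^ 2 - 2 * Dp * Dm
      = (M ^ 2 - Dm) * (X ^ 2 - 2 * (X ^ 2 - Dp)) + (X ^ 2 - Dp) * M ^ 2 := by ring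
  rcases le_or_gt (2 * (X ^ 2 - Dp)) (X ^ 2) with h1 | h1
  · rw [key]
    have : 0 ≤ X ^ 2 - 2 * (X ^ 2 - Dp) := by linarith
    nlinarith [mul_nonneg hm' this, mul_nonneg hp' (sq_nonneg M)]
  have key' : Dm * X ^ 2 + Dp * M ^ 2 - 2 * Dp * Dm
      = (X ^ 2 - Dp) * (M ^ 2 - 2 * (M ^ 2 - Dm)) + (M ^ 2 - Dm) * X ^ 2 := by ring
  rcases le_or_gt (2 * (M ^ 2 - Dm)) (M ^ 2) with h2 | h2
  · rw [key']
    have : 0 ≤ M ^ 2 - 2 * (M ^ 2 - Dm) := by linarith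
    nlinarith [mul_nonneg hp' this, mul_nonneg hm' (sq_nonneg X)]
  -- p′ := p − X²/2 > 0, m′ := m − M²/2 > 0, p′ + m′ = X·M − S′ with S′ := D⁺ + D⁻ − (X−M)²/2 ≥ 0;
  -- the form = X²M²/2 − 2p′m′ ≥ X²M²/2 − (p′+m′)²/2 = S′·(2XM − S′)/2 ≥ 0.
  have hS' : 0 ≤ Dp + Dm - (X - M) ^ 2 / 2 := by linarith
  have hsum : (X ^ 2 - Dp - X ^ 2 / 2) + (M ^ 2 - Dm - M ^ 2 / 2) = X * M - (Dp + Dm - (X - M) ^ 2 / 2) := by ring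
  have key2 : Dm * X ^ 2 + Dp * M ^ 2 - 2 * Dp * Dm
      = X ^ 2 * M ^ 2 / 2 - 2 * (X ^ 2 - Dp - X ^ 2 / 2) * (M ^ 2 - Dm - M ^ 2 / 2) := by ring
  rw [key2]
  have hpos : 0 < (X ^ 2 - Dp - X ^ 2 / 2) + (M ^ 2 - Dm - M ^ 2 / 2) := by linarith
  nlinarith [sq_nonneg ((X ^ 2 - Dp - X ^ 2 / 2) - (M ^ 2 - Dm - M ^ 2 / 2)), mul_nonneg hS' (mul_nonneg hX hM),
    mul_nonneg hS' hpos.le, hsum]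

/-- On a cross `S := Σu² − Σv² = D⁺ + D⁻ − (X − M)²/2` (corner-parametrised charges `u_e = us + x_e − y_e`, `v_g = us + q_g − p_g`, `x·y = p·q = 0`,
centring `2·us = M − X`). -/
theorem S_on_cross (x₁ x₂ x₃ x₄ x₅ y₁ y₂ y₃ y₄ y₅ p₁ p₂ p₃ q₁ q₂ q₃ us : ℝ)
    (hus : 2 * us = (y₁ + y₂ + y₃ + y₄ + y₅ + q₁ + q₂ + q₃) - (x₁ + x₂ + x₃ + x₄ + x₅ + p₁ + p₂ + p₃))
    (hxy₁ : x₁ * y₁ = 0) (hxy₂ : x₂ * y₂ = 0) (hxy₃ : x₃ * y₃ = 0) (hxy₄ : x₄ * y₄ = 0) (hxy₅ : x₅ * y₅ = 0) (hpq₁ : p₁ * q₁ = 0) (hpq₂ : p₂ * q₂ = 0) (hpq₃ : p₃ * q₃ = 0) :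
    (((us + x₁ - y₁) ^ 2 + (us + x₂ - y₂) ^ 2 + (us + x₃ - y₃) ^ 2 + (us + x₄ - y₄) ^ 2 + (us + x₅ - y₅) ^ 2) - ((us + q₁ - p₁) ^ 2 + (us + q₂ - p₂) ^ 2 + (us + q₃ - p₃) ^ 2))
      = (((x₁ ^ 2 + x₂ ^ 2 + x₃ ^ 2 + x₄ ^ 2 + x₅ ^ 2) - (p₁ ^ 2 + p₂ ^ 2 + p₃ ^ 2)) + ((y₁ ^ 2 + y₂ ^ 2 + y₃ ^ 2 + y₄ ^ 2 + y₅ ^ 2) - (q₁ ^ 2 + q₂ ^ 2 + q₃ ^ 2)) - ((x₁ + x₂ + x₃ + x₄ + x₅ + p₁ + p₂ + p₃) - (y₁ + y₂ + y₃ + y₄ + y₅ + q₁ + q₂ + q₃)) ^ 2 / 2) := by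
  linear_combination ((2 * us - ((y₁ + y₂ + y₃ + y₄ + y₅ + q₁ + q₂ + q₃) - (x₁ + x₂ + x₃ + x₄ + x₅ + p₁ + p₂ + p₃))) / 2) * hus + (-2) * hxy₁ + (-2) * hxy₂ + (-2) * hxy₃ + (-2) * hxy₄ + (-2) * hxy₅ + 2 * hpq₁ + 2 * hpq₂ + 2 * hpq₃

set_option maxHeartbeats 4000000 in
set_option maxRecDepth 16384 in
/-- THE CROSS VALUE: `Mo² + (S/2)·T² − S² − 2·S·us² = 2·(D⁻X² + D⁺M² − 2D⁺D⁻)` on a cross (corner parametrisation, `x·y = p·q = 0`, `2·us = M − X`),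
where `Mo = Σ_k ch_k·H_k`, `T = Σ_k H_k` (`H_e = x_e + y_e`, `H_g = p_g + q_g`) — the right side of `G_on_cross_53`. -/
theorem Phi_eq_core_on_cross (x₁ x₂ x₃ x₄ x₅ y₁ y₂ y₃ y₄ y₅ p₁ p₂ p₃ q₁ q₂ q₃ us : ℝ)
    (hus : 2 * us = (y₁ + y₂ + y₃ + y₄ + y₅ + q₁ + q₂ + q₃) - (x₁ + x₂ + x₃ + x₄ + x₅ + p₁ + p₂ + p₃))
    (hxy₁ : x₁ * y₁ = 0) (hxy₂ : x₂ * y₂ = 0) (hxy₃ : x₃ * y₃ = 0) (hxy₄ : x₄ * y₄ = 0) (hxy₅ : x₅ * y₅ = 0) (hpq₁ : p₁ * q₁ = 0) (hpq₂ : p₂ * q₂ = 0) (hpq₃ : p₃ * q₃ = 0) :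
    ((us + x₁ - y₁) * (x₁ + y₁) + (us + x₂ - y₂) * (x₂ + y₂) + (us + x₃ - y₃) * (x₃ + y₃) + (us + x₄ - y₄) * (x₄ + y₄) + (us + x₅ - y₅) * (x₅ + y₅) + (us + q₁ - p₁) * (p₁ + q₁) + (us + q₂ - p₂) * (p₂ + q₂) + (us + q₃ - p₃) * (p₃ + q₃)) ^ 2 + ((((us + x₁ - y₁) ^ 2 + (us + x₂ - y₂) ^ 2 + (us + x₃ - y₃) ^ 2 + (us + x₄ - y₄) ^ 2 + (us + x₅ - y₅) ^ 2) - ((us + q₁ - p₁) ^ 2 + (us + q₂ - p₂) ^ 2 + (us + q₃ - p₃) ^ 2)) / 2) * ((x₁ + x₂ + x₃ + x₄ + x₅ + p₁ + p₂ + p₃) + (y₁ + y₂ + y₃ + y₄ + y₅ + q₁ + q₂ + q₃)) ^ 2 - (((us + x₁ - y₁) ^ 2 + (us + x₂ - y₂) ^ 2 + (us + x₃ - y₃) ^ 2 + (us + x₄ - y₄) ^ 2 + (us + x₅ - y₅) ^ 2) - ((us + q₁ - p₁) ^ 2 + (us + q₂ - p₂) ^ 2 + (us + q₃ - p₃) ^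 2)) ^ 2 - 2 * (((us + x₁ - y₁) ^ 2 + (us + x₂ - y₂) ^ 2 + (us + x₃ - y₃) ^ 2 + (us + x₄ - y₄) ^ 2 + (us + x₅ - y₅) ^ 2) - ((us + q₁ - p₁) ^ 2 + (us + q₂ - p₂) ^ 2 + (us + q₃ - p₃) ^ 2)) * us ^ 2
      = 2 * (((y₁ ^ 2 + y₂ ^ 2 + y₃ ^ 2 + y₄ ^ 2 + y₅ ^ 2) - (q₁ ^ 2 + q₂ ^ 2 + q₃ ^ 2)) * (x₁ + x₂ + x₃ + x₄ + x₅ + p₁ + p₂ + p₃) ^ 2 + ((x₁ ^ 2 + x₂ ^ 2 + x₃ ^ 2 + x₄ ^ 2 + x₅ ^ 2) - (p₁ ^ 2 + p₂ ^ 2 + p₃ ^ 2)) * (y₁ + y₂ + y₃ + y₄ + y₅ + q₁ + q₂ + q₃) ^ 2 - 2 * ((x₁ ^ 2 + x₂ ^ 2 + x₃ ^ 2 + x₄ ^ 2 + x₅ ^ 2) - (p₁ ^ 2 + p₂ ^ 2 + p₃ ^ 2)) * ((y₁ ^ 2 + y₂ ^ 2 + y₃ ^ 2 + y₄ ^ 2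 + y₅ ^ 2) - (q₁ ^ 2 + q₂ ^ 2 + q₃ ^ 2))) := by
  have hus' : us = ((y₁ + y₂ + y₃ + y₄ + y₅ + q₁ + q₂ + q₃) - (x₁ + x₂ + x₃ + x₄ + x₅ + p₁ + p₂ + p₃)) / 2 := by linarith
  subst hus'
  linear_combination (-((((x₁ + x₂ + x₃ + x₄ + x₅ + p₁ + p₂ + p₃) + (y₁ + y₂ + y₃ + y₄ + y₅ + q₁ + q₂ + q₃))) ^ 2) + 4 * ((((y₁ + y₂ + y₃ + y₄ + y₅ + q₁ + q₂ + q₃) - (x₁ + x₂ + x₃ + x₄ + x₅ + p₁ + p₂ + p₃)) / 2) ^ 2) + 4 * (((x₁ ^ 2 + x₂ ^ 2 + x₃ ^ 2 + x₄ ^ 2 + x₅ ^ 2) - (p₁ ^ 2 + p₂ ^ 2 + p₃ ^ 2)) + ((y₁ ^ 2 + y₂ ^ 2 + y₃ ^ 2 + y₄ ^ 2 + y₅ ^ 2) - (q₁ ^ 2 + q₂ ^ 2 + q₃ ^ 2)) - ((x₁ + x₂ + x₃ + x₄ + x₅ + p₁ + p₂ + p₃) - (y₁ + y₂ + y₃ +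 y₄ + y₅ + q₁ + q₂ + q₃)) ^ 2 / 2) - 4 * ((x₁ * y₁ + x₂ * y₂ + x₃ * y₃ + x₄ * y₄ + x₅ * y₅) - (p₁ * q₁ + p₂ * q₂ + p₃ * q₃))) * (hxy₁ + hxy₂ + hxy₃ + hxy₄ + hxy₅ - hpq₁ - hpq₂ - hpq₃)

/-- `D⁺ ≤ X²` for nonnegative corner distances. -/
theorem Dp_le_sq (x₁ x₂ x₃ x₄ x₅ p₁ p₂ p₃ : ℝ) (hx₁ : 0 ≤ x₁) (hx₂ : 0 ≤ x₂) (hx₃ : 0 ≤ x₃) (hx₄ : 0 ≤ x₄) (hx₅ : 0 ≤ x₅) (hp₁ : 0 ≤ p₁) (hp₂ : 0 ≤ p₂) (hp₃ : 0 ≤ p₃) :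
    ((x₁ ^ 2 + x₂ ^ 2 + x₃ ^ 2 + x₄ ^ 2 + x₅ ^ 2) - (p₁ ^ 2 + p₂ ^ 2 + p₃ ^ 2)) ≤ (x₁ + x₂ + x₃ + x₄ + x₅ + p₁ + p₂ + p₃) ^ 2 := by
  have h : (x₁ + x₂ + x₃ + x₄ + x₅ + p₁ + p₂ + p₃) ^ 2 - ((x₁ ^ 2 + x₂ ^ 2 + x₃ ^ 2 + x₄ ^ 2 + x₅ ^ 2) - (p₁ ^ 2 + p₂ ^ 2 + p₃ ^ 2)) = 2 * (x₁ * x₂) + 2 * (x₁ * x₃) + 2 * (x₁ * x₄) + 2 * (x₁ * x₅) + 2 * (x₁ * p₁) + 2 * (x₁ * p₂) + 2 * (x₁ * p₃) + 2 * (x₂ * x₃) + 2 * (x₂ * x₄) + 2 * (x₂ * x₅) + 2 * (x₂ * p₁) + 2 * (x₂ * p₂) + 2 * (x₂ * p₃) + 2 * (x₃ * x₄) + 2 * (x₃ * x₅) + 2 * (x₃ * p₁) + 2 * (x₃ * p₂) + 2 * (x₃ * p₃) + 2 * (x₄ * x₅) + 2 * (x₄ * p₁) + 2 * (x₄ * p₂)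 + 2 * (x₄ * p₃) + 2 * (x₅ * p₁) + 2 * (x₅ * p₂) + 2 * (x₅ * p₃) + 2 * (p₁ * p₂) + 2 * (p₁ * p₃) + 2 * (p₂ * p₃) + 2 * p₁ ^ 2 + 2 * p₂ ^ 2 + 2 * p₃ ^ 2 := by ring
  nlinarith [mul_nonneg hx₁ hx₂, mul_nonneg hx₁ hx₃, mul_nonneg hx₁ hx₄, mul_nonneg hx₁ hx₅, mul_nonneg hx₁ hp₁, mul_nonneg hx₁ hp₂, mul_nonneg hx₁ hp₃, mul_nonneg hx₂ hx₃, mul_nonneg hx₂ hx₄, mul_nonneg hx₂ hx₅, mul_nonneg hx₂ hp₁, mul_nonneg hx₂ hp₂, mul_nonneg hx₂ hp₃, mul_nonneg hx₃ hx₄, mul_nonneg hx₃ hx₅, mul_nonneg hx₃ hp₁, mul_nonneg hx₃ hp₂, mul_nonneg hx₃ hp₃, mul_nonneg hx₄ hx₅, mul_nonneg hx₄ hp₁, mul_nonneg hx₄ hp₂, mul_nonneg hx₄ hp₃, mul_nonneg hx₅ hp₁, mul_nonneg hx₅ hp₂, mul_nonneg hx₅ hp₃, mul_nonneg hp₁ hp₂,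 mul_nonneg hp₁ hp₃, mul_nonneg hp₂ hp₃, sq_nonneg p₁, sq_nonneg p₂, sq_nonneg p₃, h]

/-- `D⁻ ≤ M²` for nonnegative corner distances. -/
theorem Dm_le_sq (y₁ y₂ y₃ y₄ y₅ q₁ q₂ q₃ : ℝ) (hy₁ : 0 ≤ y₁) (hy₂ : 0 ≤ y₂) (hy₃ : 0 ≤ y₃) (hy₄ : 0 ≤ y₄) (hy₅ : 0 ≤ y₅) (hq₁ : 0 ≤ q₁) (hq₂ : 0 ≤ q₂) (hq₃ : 0 ≤ q₃) :
    ((y₁ ^ 2 + y₂ ^ 2 + y₃ ^ 2 + y₄ ^ 2 + y₅ ^ 2) - (q₁ ^ 2 + q₂ ^ 2 + q₃ ^ 2)) ≤ (y₁ + y₂ + y₃ + y₄ + y₅ + q₁ + q₂ + q₃) ^ 2 := by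
  have h : (y₁ + y₂ + y₃ + y₄ + y₅ + q₁ + q₂ + q₃) ^ 2 - ((y₁ ^ 2 + y₂ ^ 2 + y₃ ^ 2 + y₄ ^ 2 + y₅ ^ 2) - (q₁ ^ 2 + q₂ ^ 2 + q₃ ^ 2)) = 2 * (y₁ * y₂) + 2 * (y₁ * y₃) + 2 * (y₁ * y₄) + 2 * (y₁ * y₅) + 2 * (y₁ * q₁) + 2 * (y₁ * q₂) + 2 * (y₁ * q₃) + 2 * (y₂ * y₃) + 2 * (y₂ * y₄) + 2 * (y₂ * y₅) + 2 * (y₂ * q₁) + 2 * (y₂ * q₂) + 2 * (y₂ * q₃) + 2 * (y₃ * y₄) + 2 * (y₃ * y₅) + 2 * (y₃ * q₁) + 2 * (y₃ * q₂) + 2 * (y₃ * q₃) + 2 * (y₄ * y₅) + 2 * (y₄ * q₁) + 2 * (y₄ * q₂) + 2 * (y₄ * q₃) + 2 * (y₅ * q₁) + 2 * (y₅ * q₂) + 2 * (y₅ * q₃) + 2 * (q₁ * q₂) + 2 * (q₁ * q₃) + 2 * (q₂ * q₃) + 2 * q₁ ^ 2 + 2 * q₂ ^ 2 + 2 * q₃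 ^ 2 := by ring
  nlinarith [mul_nonneg hy₁ hy₂, mul_nonneg hy₁ hy₃, mul_nonneg hy₁ hy₄, mul_nonneg hy₁ hy₅, mul_nonneg hy₁ hq₁, mul_nonneg hy₁ hq₂, mul_nonneg hy₁ hq₃, mul_nonneg hy₂ hy₃, mul_nonneg hy₂ hy₄, mul_nonneg hy₂ hy₅, mul_nonneg hy₂ hq₁, mul_nonneg hy₂ hq₂, mul_nonneg hy₂ hq₃, mul_nonneg hy₃ hy₄, mul_nonneg hy₃ hy₅, mul_nonneg hy₃ hq₁, mul_nonneg hy₃ hq₂, mul_nonneg hy₃ hq₃, mul_nonneg hy₄ hy₅, mul_nonneg hy₄ hq₁, mul_nonneg hy₄ hq₂, mul_nonneg hy₄ hq₃, mul_nonneg hy₅ hq₁, mul_nonneg hy₅ hq₂, mul_nonneg hy₅ hq₃, mul_nonneg hq₁ hq₂, mul_nonneg hq₁ hq₃, mul_nonneg hq₂ hq₃, sq_nonneg q₁, sq_nonneg q₂, sq_nonneg q₃, h]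

set_option maxHeartbeats 4000000 in
set_option maxRecDepth 16384 in
/-- **CONJECTURE N ON CROSSES, WITHOUT (P1).** A centred format-(5,3) configuration whose roots all lie on the two null lines through a base point
`(As, us)` — E-roots `(As + x_e + y_e, us + x_e − y_e)`, F-roots `(As − p_g − q_g, us + q_g − p_g)`, `x, y, p, q ≥ 0`, `x_e·y_e = p_g·q_g = 0` (such a
configuration is automatically pairwise ample) — with `P2 = 0`, `P4 = 0` and `S = Σu² − Σv² ≥ 0` satisfies `G = Q₂ + Q₄ ≥ 0`. -/
theorem conjectureN_53_cross (A₁ A₂ A₃ A₄ A₅ B₁ B₂ B₃ u₁ u₂ u₃ u₄ u₅ v₁ v₂ v₃ As us : ℝ) (x₁ x₂ x₃ x₄ x₅ y₁ y₂ y₃ y₄ y₅ p₁ p₂ p₃ q₁ q₂ q₃ : ℝ)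
    (hA : A₁ + A₂ + A₃ + A₄ + A₅ = B₁ + B₂ + B₃) (hC : u₁ + u₂ + u₃ + u₄ + u₅ = v₁ + v₂ + v₃)
    (hP2 : ((A₁ * u₁ ^ 2 + A₂ * u₂ ^ 2 + A₃ * u₃ ^ 2 + A₄ * u₄ ^ 2 + A₅ * u₅ ^ 2) - (B₁ * v₁ ^ 2 + B₂ * v₂ ^ 2 + B₃ * v₃ ^ 2)) = 0)
    (hP4 : ((u₁ ^ 3 + u₂ ^ 3 + u₃ ^ 3 + u₄ ^ 3 + u₅ ^ 3) - (v₁ ^ 3 + v₂ ^ 3 + v₃ ^ 3)) = 0)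
    (hS : 0 ≤ ((u₁ ^ 2 + u₂ ^ 2 + u₃ ^ 2 + u₄ ^ 2 + u₅ ^ 2) - (v₁ ^ 2 + v₂ ^ 2 + v₃ ^ 2)))
    (hA₁ : A₁ = As + x₁ + y₁) (hA₂ : A₂ = As + x₂ + y₂) (hA₃ : A₃ = As + x₃ + y₃) (hA₄ : A₄ = As + x₄ + y₄) (hA₅ : A₅ = As + x₅ + y₅) (hu₁ : u₁ = us + x₁ - y₁) (hu₂ : u₂ = us + x₂ - y₂) (hu₃ : u₃ = us + x₃ - y₃) (hu₄ : u₄ = us + x₄ - y₄) (hu₅ : u₅ = us + x₅ - y₅) (hB₁ : B₁ = As - p₁ - q₁) (hB₂ : B₂ = As - p₂ - q₂) (hB₃ : B₃ = As - p₃ - q₃) (hv₁ : v₁ = us + q₁ - p₁) (hv₂ : v₂ = us + q₂ - p₂) (hv₃ : v₃ = us + q₃ - p₃)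
    (hx₁ : 0 ≤ x₁) (hx₂ : 0 ≤ x₂) (hx₃ : 0 ≤ x₃) (hx₄ : 0 ≤ x₄) (hx₅ : 0 ≤ x₅) (hy₁ : 0 ≤ y₁) (hy₂ : 0 ≤ y₂) (hy₃ : 0 ≤ y₃) (hy₄ : 0 ≤ y₄) (hy₅ : 0 ≤ y₅) (hp₁ : 0 ≤ p₁) (hp₂ : 0 ≤ p₂) (hp₃ : 0 ≤ p₃) (hq₁ : 0 ≤ q₁) (hq₂ : 0 ≤ q₂) (hq₃ : 0 ≤ q₃)
    (hxy₁ : x₁ * y₁ = 0) (hxy₂ : x₂ * y₂ = 0) (hxy₃ : x₃ * y₃ = 0) (hxy₄ : x₄ * y₄ = 0) (hxy₅ : x₅ * y₅ = 0) (hpq₁ : p₁ * q₁ = 0) (hpq₂ : p₂ * q₂ = 0) (hpq₃ : p₃ * q₃ = 0) :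
    0 ≤ (1 / 2) * ((A₁ ^ 2 + A₂ ^ 2 + A₃ ^ 2 + A₄ ^ 2 + A₅ ^ 2) - (B₁ ^ 2 + B₂ ^ 2 + B₃ ^ 2)) * ((u₁ ^ 2 + u₂ ^ 2 + u₃ ^ 2 + u₄ ^ 2 + u₅ ^ 2) - (v₁ ^ 2 + v₂ ^ 2 + v₃ ^ 2))
        + ((A₁ * u₁ + A₂ * u₂ + A₃ * u₃ + A₄ * u₄ + A₅ * u₅) - (B₁ * v₁ + B₂ * v₂ + B₃ * v₃)) ^ 2
        - 3 * ((A₁ ^ 2 * u₁ ^ 2 + A₂ ^ 2 * u₂ ^ 2 + A₃ ^ 2 * u₃ ^ 2 + A₄ ^ 2 * u₄ ^ 2 + A₅ ^ 2 * u₅ ^ 2) - (B₁ ^ 2 * v₁ ^ 2 + B₂ ^ 2 * v₂ ^ 2 + B₃ ^ 2 * v₃ ^ 2))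
      + (3 * ((u₁ ^ 4 + u₂ ^ 4 + u₃ ^ 4 + u₄ ^ 4 + u₅ ^ 4) - (v₁ ^ 4 + v₂ ^ 4 + v₃ ^ 4)) - (3 / 2) * ((u₁ ^ 2 + u₂ ^ 2 + u₃ ^ 2 + u₄ ^ 2 + u₅ ^ 2) - (v₁ ^ 2 + v₂ ^ 2 + v₃ ^ 2)) ^ 2) := by
  have hG := G_on_cross_53 A₁ A₂ A₃ A₄ A₅ B₁ B₂ B₃ u₁ u₂ u₃ u₄ u₅ v₁ v₂ v₃ As us hA hC hP2 hP4
    (by rw [hA₁, hu₁]; linear_combination 4 * hxy₁) (by rw [hA₂, hu₂]; linear_combination 4 * hxy₂) (by rw [hA₃, hu₃]; linear_combination 4 * hxy₃) (by rw [hA₄, hu₄]; linear_combination 4 * hxy₄) (by rw [hA₅, hu₅]; linear_combination 4 * hxy₅) (by rw [hB₁, hv₁]; linear_combination 4 * hpq₁) (by rw [hB₂, hv₂]; linear_combination 4 * hpq₂) (by rw [hB₃, hv₃]; linear_combination 4 * hpq₃)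
  rw [hG]
  have hus : 2 * us = (y₁ + y₂ + y₃ + y₄ + y₅ + q₁ + q₂ + q₃) - (x₁ + x₂ + x₃ + x₄ + x₅ + p₁ + p₂ + p₃) := by
    have h := hC
    rw [hu₁, hu₂, hu₃, hu₄, hu₅, hv₁, hv₂, hv₃] at h
    linarith
  have hSc : ((u₁ ^ 2 + u₂ ^ 2 + u₃ ^ 2 + u₄ ^ 2 + u₅ ^ 2) - (v₁ ^ 2 + v₂ ^ 2 + v₃ ^ 2)) = (((x₁ ^ 2 + x₂ ^ 2 + x₃ ^ 2 + x₄ ^ 2 + x₅ ^ 2) - (p₁ ^ 2 + p₂ ^ 2 + p₃ ^ 2)) + ((y₁ ^ 2 + y₂ ^ 2 + y₃ ^ 2 + y₄ ^ 2 + y₅ ^ 2) - (q₁ ^ 2 + q₂ ^ 2 + q₃ ^ 2)) - ((x₁ + x₂ + x₃ + x₄ + x₅ + p₁ + p₂ + p₃) - (y₁ + y₂ + y₃ + y₄ + y₅ + q₁ + q₂ + q₃)) ^ 2 / 2) := by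
    rw [hu₁, hu₂, hu₃, hu₄, hu₅, hv₁, hv₂, hv₃]
    exact S_on_cross x₁ x₂ x₃ x₄ x₅ y₁ y₂ y₃ y₄ y₅ p₁ p₂ p₃ q₁ q₂ q₃ us hus hxy₁ hxy₂ hxy₃ hxy₄ hxy₅ hpq₁ hpq₂ hpq₃
  have hPhi := Phi_eq_core_on_cross x₁ x₂ x₃ x₄ x₅ y₁ y₂ y₃ y₄ y₅ p₁ p₂ p₃ q₁ q₂ q₃ us hus hxy₁ hxy₂ hxy₃ hxy₄ hxy₅ hpq₁ hpq₂ hpq₃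
  have hX : 0 ≤ (x₁ + x₂ + x₃ + x₄ + x₅ + p₁ + p₂ + p₃) := by positivity
  have hM : 0 ≤ (y₁ + y₂ + y₃ + y₄ + y₅ + q₁ + q₂ + q₃) := by positivity
  have hDp := Dp_le_sq x₁ x₂ x₃ x₄ x₅ p₁ p₂ p₃ hx₁ hx₂ hx₃ hx₄ hx₅ hp₁ hp₂ hp₃
  have hDm := Dm_le_sq y₁ y₂ y₃ y₄ y₅ q₁ q₂ q₃ hy₁ hy₂ hy₃ hy₄ hy₅ hq₁ hq₂ hq₃
  have hS0 : ((x₁ + x₂ + x₃ + x₄ + x₅ + p₁ + p₂ + p₃) - (y₁ + y₂ + y₃ + y₄ + y₅ + q₁ + q₂ + q₃)) ^ 2 / 2 ≤ ((x₁ ^ 2 + x₂ ^ 2 + x₃ ^ 2 + x₄ ^ 2 + x₅ ^ 2) - (p₁ ^ 2 + p₂ ^ 2 + p₃ ^ 2)) + ((y₁ ^ 2 + y₂ ^ 2 + y₃ ^ 2 + y₄ ^ 2 + y₅ ^ 2) - (q₁ ^ 2 + q₂ ^ 2 + q₃ ^ 2)) := by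
    have : 0 ≤ (((x₁ ^ 2 + x₂ ^ 2 + x₃ ^ 2 + x₄ ^ 2 + x₅ ^ 2) - (p₁ ^ 2 + p₂ ^ 2 + p₃ ^ 2)) + ((y₁ ^ 2 + y₂ ^ 2 + y₃ ^ 2 + y₄ ^ 2 + y₅ ^ 2) - (q₁ ^ 2 + q₂ ^ 2 + q₃ ^ 2)) - ((x₁ + x₂ + x₃ + x₄ + x₅ + p₁ + p₂ + p₃) - (y₁ + y₂ + y₃ + y₄ + y₅ + q₁ + q₂ + q₃)) ^ 2 / 2) := by rw [← hSc]; exact hS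
    linarith
  have hcore := cross_lemma_core (x₁ + x₂ + x₃ + x₄ + x₅ + p₁ + p₂ + p₃) (y₁ + y₂ + y₃ + y₄ + y₅ + q₁ + q₂ + q₃) ((x₁ ^ 2 + x₂ ^ 2 + x₃ ^ 2 + x₄ ^ 2 + x₅ ^ 2) - (p₁ ^ 2 + p₂ ^ 2 + p₃ ^ 2)) ((y₁ ^ 2 + y₂ ^ 2 + y₃ ^ 2 + y₄ ^ 2 + y₅ ^ 2) - (q₁ ^ 2 + q₂ ^ 2 + q₃ ^ 2)) hX hM hDp hDm hS0
  -- rewrite the goal into corner coordinates and close with hPhi, hcore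
  have goal_eq : (u₁ * (A₁ - As) + u₂ * (A₂ - As) + u₃ * (A₃ - As) + u₄ * (A₄ - As) + u₅ * (A₅ - As) + v₁ * (As - B₁) + v₂ * (As - B₂) + v₃ * (As - B₃)) ^ 2
        + (((u₁ ^ 2 + u₂ ^ 2 + u₃ ^ 2 + u₄ ^ 2 + u₅ ^ 2) - (v₁ ^ 2 + v₂ ^ 2 + v₃ ^ 2)) / 2) * ((A₁ - As) + (A₂ - As) + (A₃ - As) + (A₄ - As) + (A₅ - As) + (As - B₁) + (As - B₂) + (As - B₃)) ^ 2
        - ((u₁ ^ 2 + u₂ ^ 2 + u₃ ^ 2 + u₄ ^ 2 + u₅ ^ 2) - (v₁ ^ 2 + v₂ ^ 2 + v₃ ^ 2)) ^ 2 - 2 * ((u₁ ^ 2 + u₂ ^ 2 + u₃ ^ 2 + u₄ ^ 2 + u₅ ^ 2) - (v₁ ^ 2 + v₂ ^ 2 + v₃ ^ 2)) * us ^ 2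
      = 2 * (((y₁ ^ 2 + y₂ ^ 2 + y₃ ^ 2 + y₄ ^ 2 + y₅ ^ 2) - (q₁ ^ 2 + q₂ ^ 2 + q₃ ^ 2)) * (x₁ + x₂ + x₃ + x₄ + x₅ + p₁ + p₂ + p₃) ^ 2 + ((x₁ ^ 2 + x₂ ^ 2 + x₃ ^ 2 + x₄ ^ 2 + x₅ ^ 2) - (p₁ ^ 2 + p₂ ^ 2 + p₃ ^ 2)) * (y₁ + y₂ + y₃ + y₄ + y₅ + q₁ + q₂ + q₃) ^ 2 - 2 * ((x₁ ^ 2 + x₂ ^ 2 + x₃ ^ 2 + x₄ ^ 2 + x₅ ^ 2) - (p₁ ^ 2 + p₂ ^ 2 + p₃ ^ 2)) * ((y₁ ^ 2 + y₂ ^ 2 + y₃ ^ 2 + y₄ ^ 2 + y₅ ^ 2) - (q₁ ^ 2 + q₂ ^ 2 + q₃ ^ 2))) := by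
    rw [hA₁, hA₂, hA₃, hA₄, hA₅, hu₁, hu₂, hu₃, hu₄, hu₅, hB₁, hB₂, hB₃, hv₁, hv₂, hv₃]
    rw [← hPhi]
    ring
  rw [goal_eq]
  linarith [hcore]

end Summit.HodgeConjecture.HodgeConjecture.WeilClassTestFormatFiveThreeCrossLemma
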